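import Summits.Ventures.YMGap.RobustBall.PlaquettePositivityOneLink
import Literature.MathematicalPhysics.QuantumFieldTheory.Balaban1983to89.MassGapDobrushinNoGo
import HarnessLib

/-!
# Venture YMGap, track ROBUST-BALL — plaquette positivity II: resampling a staple link

HONEST FRAMING. WHAT THIS IS: a venture file (cell `pub-ymgap`, track Y2, seat rb-p2 g3): LATTICE
statements about Wilson's `SU(N)` lattice gauge theory on `ℤ^d` (DLR description), valid at EVERY
`β ≥ 0`. WHAT IT IS NOT: nothing about the continuum limit, a spectral gap, or a Clay-sense mass gap.

Part II of three. CONTENT: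
* geometry at the origin: the plaquette `p₀ = (0; 0,1)`, its first link `e₀ = (0,0)` and second link
  `f₀ = (ê₀, 1)`; a plaquette containing both `e₀` and `f₀` is `p₀` (`eq_origin_plaquette_of_mem`);
* resampling the variable at `f₀` by Haar measure turns the staple of `p₀` at `e₀` into `h · c(η)` and
  leaves every other staple at `e₀` unchanged, so the Haar average of the squared staple form is
  `∫ (rest)² + V₀ ≥ V₀` (`charVariance_le_integral_sq_update`);
* through the DLR kernel at `f₀` (density `≥ e^{-2βN #{p ∋ f₀}}`) and the kernel bound of part I at
  `e₀`, for every Gibbs measure `μ` of the Wilson specification at `β ≥ 0` (`G ≅ SU(N)`, `N ≥ 2`,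
  `d ≥ 2`): **`∫ ∑_{p ∋ e₀} Re tr ρ(U_p) dμ ≥ β e^{-8(d-1)Nβ} V₀`** (`integral_sum_plaquetteObs_ge`;
  `#{p ∋ e} = 2(d-1)` is the tree's `card_plaquettesTouching_singleton`).

References: E. Seiler, LNP 159 (1982), §2; H.-O. Georgii (2011), Remark 1.24. Everything here is
proved; no definition, no named fact. [folklore]
-/

noncomputable section

open MeasureTheory Filter Topology Finset
open Literature.Probability.LatticeModels Literature.Probability.LatticeModels.DobrushinMetric
open Literature.MathematicalPhysics.QuantumLattice Literature.MathematicalPhysics.QuantumFieldTheory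

namespace Summit.Ventures.YMGap.RobustBall

namespace PlaquettePositivity

/-! ### Part D — geometry of one plaquette at the origin and the resampling of a staple link -/

section Geometry

variable {d : ℕ} [NeZero d]

/-- The plaquette `p₀` at the origin of `ℤ^d` in the `(0,1)` plane (`d ≥ 2`). [folklore] -/
theorem fin_zero_lt_one (hd : 2 ≤ d) : (0 : Fin d) < 1 :=
  lt_of_le_of_ne (Fin.zero_le _) (TorusAreaLaw.fin_zero_ne_one hd)

variable {G : Type*} [Group G]

omit [NeZero d] in
/-- The staple links of a plaquette at one of its links are links of the plaquette. [folklore] -/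
theorem stapleLinks_mem_plaquetteEdges (p : ZdPlaquette d)
    (x : Literature.MathematicalPhysics.QuantumLattice.ZdEdge d) (k : Fin 3) :
    stapleLinks p x k ∈ plaquetteEdges p := by
  rw [plaquetteEdges_eq]
  unfold stapleLinks
  split_ifs <;> fin_cases k <;> simp

/-- **Two links determine the plaquette**: a plaquette of `ℤ^d` containing both the link `(0, 0)`
and the link `(e₀, 1)` is the plaquette at the origin in the `(0,1)` plane. [folklore] -/
theorem eq_origin_plaquette_of_mem (hd : 2 ≤ d) (p : ZdPlaquette d)
    (h0 : ((0 : Literature.Probability.LatticeModels.Site d), (0 : Fin d)) ∈ plaquetteEdges p)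
    (h1 : ((0 : Literature.Probability.LatticeModels.Site d) + Pi.single (0 : Fin d) 1, (1 : Fin d)) ∈
      plaquetteEdges p) :
    p = ((0 : Literature.Probability.LatticeModels.Site d), ⟨((0 : Fin d), (1 : Fin d)), fin_zero_lt_one hd⟩) := by
  have h01 : (0 : Fin d) ≠ 1 := TorusAreaLaw.fin_zero_ne_one hd
  obtain ⟨y, ⟨⟨i, j⟩, hij⟩⟩ := p
  simp only at hij
  have hj0 : j ≠ 0 := fun h => by rw [h] at hij; exact (Fin.not_lt_zero _ hij).elim
  simp only [plaquetteEdges, Finset.mem_insert, Finset.mem_singleton, Prod.mk.injEq, zero_add] at h0 h1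
  -- single-coordinate facts in `ℤ^d`
  have hs0 : (Pi.single (0 : Fin d) (1 : ℤ) : Fin d → ℤ) 0 = 1 := by simp
  have hs1 : (Pi.single (1 : Fin d) (1 : ℤ) : Fin d → ℤ) 0 = 0 := by simp [h01]
  -- from `h0`: `i = 0` and (`y = 0` or `y + e_j = 0`)
  have hi : i = 0 := by
    rcases h0 with ⟨-, h⟩ | ⟨-, h⟩ | ⟨-, h⟩ | ⟨-, h⟩
    · exact h.symm
    · exact absurd h.symm hj0
    · exact h.symm
    · exact absurd h.symm hj0
  subst hi
  have hy : y = 0 ∨ y + Pi.single j 1 = 0 := by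
    rcases h0 with ⟨h, -⟩ | ⟨-, h⟩ | ⟨h, -⟩ | ⟨-, h⟩
    · exact Or.inl h.symm
    · exact absurd h.symm hj0
    · exact Or.inr h.symm
    · exact absurd h.symm hj0
  -- from `h1`: `j = 1` and (`y + e_0 = e_0` or `y = e_0`)
  have hj : j = 1 ∧ (y + Pi.single (0 : Fin d) 1 = Pi.single (0 : Fin d) 1 ∨ y = Pi.single (0 : Fin d) 1) := by
    rcases h1 with ⟨-, h⟩ | ⟨h, h'⟩ | ⟨-, h⟩ | ⟨h, h'⟩
    · exact absurd h.symm h01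
    · exact ⟨h'.symm, Or.inl h.symm⟩
    · exact absurd h.symm h01
    · exact ⟨h'.symm, Or.inr h.symm⟩
  obtain ⟨rfl, hy'⟩ := hj
  have hy0 : y = 0 := by
    rcases hy' with h | h
    · simpa using h
    · rcases hy with h' | h'
      · exact h'
      · exfalso
        rw [h] at h'
        have := congrFun h' 0
        simp only [Pi.add_apply, hs0, hs1, Pi.zero_apply] at this
        omega
  subst hy0
  rcases hy' with h | h
  · rfl
  · exfalso
    have := congrFun h 0
    simp only [Pi.zero_apply, hs0] at this
    omega

end Geometry

section Resample

variable {d N : ℕ} [NeZero d] {G : Type*} [Group G] [TopologicalSpace G] [IsTopologicalGroup G]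
  [CompactSpace G] [MeasurableSpace G] [BorelSpace G] (ρ : G →* Matrix (Fin N) (Fin N) ℂ)

omit [NeZero d] [CompactSpace G] [MeasurableSpace G] [BorelSpace G] in
/-- The staple is a continuous function of the configuration. [folklore] -/
theorem continuous_staple (p : ZdPlaquette d) (x : Literature.MathematicalPhysics.QuantumLattice.ZdEdge d) :
    Continuous fun ω : LGConfig d G => staple p x ω := by
  unfold staple
  split_ifs <;> fun_prop

/-- **Resampling the staple link**: writing `p₀` for the origin plaquette in the `(0,1)` plane,
`e₀ = (0,0)` for its first link and `f₀ = (e₀, 1)` for its second link, replacing the variable at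
`f₀` by `h` changes the staple of `p₀` at `e₀` to `h · c(η)` and no other staple at `e₀`, so the
Haar average over `h` of the squared staple form is `∫ (rest)² + V₀ ≥ V₀`. [folklore] -/
theorem charVariance_le_integral_sq_update (hρ : IsSpecialUnitaryModel ρ) (hN : 2 ≤ N) (hd : 2 ≤ d)
    (η : LGConfig d G) :
    PlaquetteLowerBound.charVariance ρ ≤
      ∫ h, ∫ g, (∑ p ∈ plaquettesTouching
          {plaqLink1 ((0 : Literature.Probability.LatticeModels.Site d), ⟨((0 : Fin d), (1 : Fin d)), fin_zero_lt_one hd⟩)},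
        (ρ g * ρ (staple p
          (plaqLink1 ((0 : Literature.Probability.LatticeModels.Site d), ⟨((0 : Fin d), (1 : Fin d)), fin_zero_lt_one hd⟩))
          (Function.update η
            (plaqLink2 ((0 : Literature.Probability.LatticeModels.Site d), ⟨((0 : Fin d), (1 : Fin d)), fin_zero_lt_one hd⟩))
            h))).trace.re) ^ 2 ∂haarProbability G ∂haarProbability G := by
  haveI := IsSpecialUnitaryModel.secondCountableTopology ρ hρ
  set p₀ : ZdPlaquette d := ((0 : Literature.Probability.LatticeModels.Site d),
    ⟨((0 : Fin d), (1 : Fin d)), fin_zero_lt_one hd⟩) with hp₀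
  set e₀ := plaqLink1 p₀ with he₀
  set f₀ := plaqLink2 p₀ with hf₀
  set T := plaquettesTouching {e₀} with hT
  have he₀' : e₀ = ((0 : Literature.Probability.LatticeModels.Site d), (0 : Fin d)) := rfl
  have hf₀' : f₀ = ((0 : Literature.Probability.LatticeModels.Site d) + Pi.single (0 : Fin d) 1, (1 : Fin d)) := rfl
  have hp₀T : p₀ ∈ T := by
    rw [hT, mem_plaquettesTouching_singleton, plaquetteEdges_eq]
    simp [he₀]
  -- the staple of `p₀` at `e₀` after the update
  set c : G := (η (plaqLink3 p₀))⁻¹ * (η (plaqLink4 p₀))⁻¹ with hc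
  have hst0 : ∀ h : G, staple p₀ e₀ (Function.update η f₀ h) = h * c := by
    intro h
    unfold staple
    rw [if_pos rfl, Function.update_self,
      Function.update_of_ne (plaqLink2_ne_plaqLink3 p₀).symm,
      Function.update_of_ne (plaqLink2_ne_plaqLink4 p₀).symm, hc, mul_assoc]
  -- the other staples at `e₀` do not read `f₀`
  have hst : ∀ p ∈ T.erase p₀, ∀ h : G, staple p e₀ (Function.update η f₀ h) = staple p e₀ η := by
    intro p hp h
    obtain ⟨hne, hpT⟩ := Finset.mem_erase.1 hp
    refine staple_congr fun k => Function.update_of_ne ?_ _ _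
    intro hk
    have hf : f₀ ∈ plaquetteEdges p := hk ▸ stapleLinks_mem_plaquetteEdges p e₀ k
    have he : e₀ ∈ plaquetteEdges p := by rw [hT, mem_plaquettesTouching_singleton] at hpT; exact hpT
    rw [he₀'] at he; rw [hf₀'] at hf
    exact hne (eq_origin_plaquette_of_mem hd p he hf)
  -- rewrite the staple form
  set A : G → ℝ := fun g => ∑ p ∈ T.erase p₀, (ρ g * ρ (staple p e₀ η)).trace.re with hA
  have hsum : ∀ h g : G, ∑ p ∈ T, (ρ g * ρ (staple p e₀ (Function.update η f₀ h))).trace.re =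
      A g + (ρ (g * h * c)).trace.re := by
    intro h g
    rw [← Finset.add_sum_erase T _ hp₀T, hst0 h, add_comm, hA]
    simp only
    congr 1
    · exact Finset.sum_congr rfl fun p hp => by rw [hst p hp h]
    · rw [← map_mul, mul_assoc]
  simp_rw [hsum]
  -- swap the integrals and compute the inner one
  have hAc : Continuous A := by
    refine continuous_finsetSum _ fun p _ => ?_
    simp_rw [← map_mul]
    exact (continuous_trace_re ρ hρ.1).comp (continuous_id.mul continuous_const)
  have hFc : Continuous fun z : G × G => (A z.2 + (ρ (z.2 * z.1 * c)).trace.re) ^ 2 :=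
    ((hAc.comp continuous_snd).add ((continuous_trace_re ρ hρ.1).comp
      ((continuous_snd.mul continuous_fst).mul continuous_const))).pow 2
  have hFi : Integrable (Function.uncurry fun h g : G => (A g + (ρ (g * h * c)).trace.re) ^ 2)
      ((haarProbability G).prod (haarProbability G)) :=
    hFc.integrable_of_hasCompactSupport (HasCompactSupport.of_compactSpace _)
  rw [integral_integral_swap hFi]
  simp_rw [integral_add_reTr_sq ρ hρ hN]
  have hi : Integrable (fun g : G => A g ^ 2) (haarProbability G) :=
    (hAc.pow 2).integrable_of_hasCompactSupport (HasCompactSupport.of_compactSpace _)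
  rw [integral_add hi (integrable_const _)]
  have h0 : 0 ≤ ∫ g, A g ^ 2 ∂haarProbability G := integral_nonneg fun g => sq_nonneg _
  simp only [integral_const, probReal_univ, one_smul]
  linarith

end Resample

/-! ### Part E — the squared staple form as an observable; the two kernel bounds integrated -/

section Kernel

variable {d N : ℕ} [NeZero d] {G : Type*} [Group G] [TopologicalSpace G] [IsTopologicalGroup G]
  [CompactSpace G] [MeasurableSpace G] [BorelSpace G] [SecondCountableTopology G] [T2Space G]
  (ρ : G →* Matrix (Fin N) (Fin N) ℂ)

omit [NeZero d] [T2Space G] in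
/-- The squared staple form `η ↦ ∫ (∑_{p ∋ e} Re tr(ρ(g) ρ(staple_p^e(η))))² dg` is a measurable
observable (a parametric Haar integral of a jointly continuous integrand). [folklore] -/
theorem measurable_integral_sq_sum (hρ : Continuous ρ) (e : Literature.MathematicalPhysics.QuantumLattice.ZdEdge d) :
    Measurable fun η : LGConfig d G =>
      ∫ g, (∑ p ∈ plaquettesTouching {e}, (ρ g * ρ (staple p e η)).trace.re) ^ 2 ∂haarProbability G := by
  have hF : Continuous fun z : LGConfig d G × G =>
      (∑ p ∈ plaquettesTouching {e}, (ρ z.2 * ρ (staple p e z.1)).trace.re) ^ 2 := by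
    refine (continuous_finsetSum _ fun p _ => ?_).pow 2
    simp_rw [← map_mul]
    exact (continuous_trace_re ρ hρ).comp (continuous_snd.mul ((continuous_staple p e).comp continuous_fst))
  exact (hF.stronglyMeasurable.integral_prod_right' (ν := haarProbability G)).measurable

omit [NeZero d] [SecondCountableTopology G] [T2Space G] in
/-- Bounds `0 ≤ ∫ (staple form)² ≤ (N #{p ∋ e})²`. [folklore] -/
theorem integral_sq_sum_nonneg_le (hρu : ∀ g, ρ g ∈ Matrix.unitaryGroup (Fin N) ℂ)
    (e : Literature.MathematicalPhysics.QuantumLattice.ZdEdge d) (η : LGConfig d G) :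
    0 ≤ ∫ g, (∑ p ∈ plaquettesTouching {e}, (ρ g * ρ (staple p e η)).trace.re) ^ 2 ∂haarProbability G ∧
      ∫ g, (∑ p ∈ plaquettesTouching {e}, (ρ g * ρ (staple p e η)).trace.re) ^ 2 ∂haarProbability G ≤
        ((plaquettesTouching {e}).card * N) ^ 2 := by
  refine ⟨integral_nonneg fun g => sq_nonneg _, ?_⟩
  have hb : ∀ g, (∑ p ∈ plaquettesTouching {e}, (ρ g * ρ (staple p e η)).trace.re) ^ 2 ≤
      ((plaquettesTouching {e}).card * N) ^ 2 := fun g => by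
    have h := abs_sum_re_trace_staple_le ρ hρu e η g
    have h0 : 0 ≤ ((plaquettesTouching {e}).card : ℝ) * N := by positivity
    rw [← sq_abs]
    exact pow_le_pow_left₀ (abs_nonneg _) h 2
  calc ∫ g, (∑ p ∈ plaquettesTouching {e}, (ρ g * ρ (staple p e η)).trace.re) ^ 2 ∂haarProbability G
      ≤ ∫ _g, ((plaquettesTouching {e}).card * (N : ℝ)) ^ 2 ∂haarProbability G := by
        refine integral_mono_of_nonneg (ae_of_all _ fun g => sq_nonneg _) (integrable_const _)
          (ae_of_all _ hb)
    _ = ((plaquettesTouching {e}).card * N) ^ 2 := by simp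

omit [NeZero d] [TopologicalSpace G] [IsTopologicalGroup G] [CompactSpace G] [MeasurableSpace G] [BorelSpace G]
  [SecondCountableTopology G] [T2Space G] in
/-- The boundary Wilson action of one link lies in `[0, 2N #{p ∋ f}]`. [folklore] -/
theorem wilsonBoundaryAction_singleton_mem (hρu : ∀ g, ρ g ∈ Matrix.unitaryGroup (Fin N) ℂ)
    (f : Literature.MathematicalPhysics.QuantumLattice.ZdEdge d) (U : LGConfig d G) :
    0 ≤ wilsonBoundaryAction ρ {f} U ∧
      wilsonBoundaryAction ρ {f} U ≤ 2 * N * (plaquettesTouching {f}).card := by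
  unfold wilsonBoundaryAction
  have hterm : ∀ p ∈ plaquettesTouching {f},
      0 ≤ (N : ℝ) - plaquetteObs ρ p.1 p.2.1.1 p.2.1.2 U ∧
        (N : ℝ) - plaquetteObs ρ p.1 p.2.1.1 p.2.1.2 U ≤ 2 * N := fun p _ => by
    have h := abs_re_trace_le_of_mem_unitaryGroup (hρu (plaquetteHolonomyZd U p.1 p.2.1.1 p.2.1.2))
    simp only [plaquetteObs]
    constructor <;> linarith [(abs_le.1 h).1, (abs_le.1 h).2]
  constructor
  · exact Finset.sum_nonneg fun p hp => (hterm p hp).1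
  · calc ∑ p ∈ plaquettesTouching {f}, ((N : ℝ) - plaquetteObs ρ p.1 p.2.1.1 p.2.1.2 U)
        ≤ ∑ _p ∈ plaquettesTouching {f}, (2 * (N : ℝ)) := Finset.sum_le_sum fun p hp => (hterm p hp).2
      _ = 2 * N * (plaquettesTouching {f}).card := by rw [Finset.sum_const, nsmul_eq_mul]; ring

/-- **Resampling a staple link through the DLR kernel.** For every boundary condition `η`, the
one-link kernel at the second link `f₀` of the origin plaquette gives the squared staple form at
`e₀ = (0,0)` a mean `≥ e^{-2βN #{p ∋ f₀}} V₀` (kernel density `≥ e^{-osc}`, Haar resampling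
`charVariance_le_integral_sq_update`). [folklore] -/
theorem siteAvg_integral_sq_sum_ge (hρ : IsSpecialUnitaryModel ρ) (hN : 2 ≤ N) (hd : 2 ≤ d)
    {β : ℝ} (hβ : 0 ≤ β) (η : LGConfig d G) :
    Real.exp (-(β * (2 * N * (plaquettesTouching
        {plaqLink2 ((0 : Literature.Probability.LatticeModels.Site d), ⟨((0 : Fin d), (1 : Fin d)), fin_zero_lt_one hd⟩)}).card))) *
        PlaquetteLowerBound.charVariance ρ ≤
      siteAvg (ymSpecification ρ β)
        (plaqLink2 ((0 : Literature.Probability.LatticeModels.Site d), ⟨((0 : Fin d), (1 : Fin d)), fin_zero_lt_one hd⟩))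
        (fun η' : LGConfig d G => ∫ g, (∑ p ∈ plaquettesTouching
          {plaqLink1 ((0 : Literature.Probability.LatticeModels.Site d), ⟨((0 : Fin d), (1 : Fin d)), fin_zero_lt_one hd⟩)},
          (ρ g * ρ (staple p
            (plaqLink1 ((0 : Literature.Probability.LatticeModels.Site d), ⟨((0 : Fin d), (1 : Fin d)), fin_zero_lt_one hd⟩))
            η')).trace.re) ^ 2 ∂haarProbability G) η := by
  set p₀ : ZdPlaquette d := ((0 : Literature.Probability.LatticeModels.Site d),
    ⟨((0 : Fin d), (1 : Fin d)), fin_zero_lt_one hd⟩) with hp₀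
  set e₀ := plaqLink1 p₀ with he₀
  set f₀ := plaqLink2 p₀ with hf₀
  have hu := IsSpecialUnitaryModel.mem_unitaryGroup ρ hρ
  have hγ := isSpecification_ymSpecification_of_t2Space (d := d) ρ hρ.1 β
  set Q : LGConfig d G → ℝ := fun η' =>
    ∫ g, (∑ p ∈ plaquettesTouching {e₀}, (ρ g * ρ (staple p e₀ η')).trace.re) ^ 2 ∂haarProbability G
    with hQ
  have hQm : Measurable Q := measurable_integral_sq_sum ρ hρ.1 e₀
  rw [siteAvg_eq_integral_siteLaw hγ f₀ hQm η, siteLaw_ymSpecification_eq_tilted_haar ρ hρ.1 β f₀ η]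
  -- the kernel density is at least `e^{-D}`
  set D : ℝ := β * (2 * N * (plaquettesTouching {f₀}).card) with hD
  have hφm : Measurable fun h : G => -β * wilsonBoundaryAction ρ {f₀} (Function.update η f₀ h) :=
    ((continuous_const.mul (continuous_wilsonBoundaryAction ρ hρ.1 {f₀})).measurable).comp
      (measurable_update η)
  have hφ : ∀ᵐ h ∂haarProbability G, -D ≤ -β * wilsonBoundaryAction ρ {f₀} (Function.update η f₀ h) ∧
      -β * wilsonBoundaryAction ρ {f₀} (Function.update η f₀ h) ≤ -D + D := by
    refine ae_of_all _ fun h => ?_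
    have hb := wilsonBoundaryAction_singleton_mem ρ hu f₀ (Function.update η f₀ h)
    constructor
    · rw [hD]; nlinarith [hb.2]
    · rw [neg_add_cancel]; nlinarith [hb.1]
  have hX := exp_neg_mul_integral_le_integral_tilted (ν := haarProbability G)
    (X := fun h => Q (Function.update η f₀ h)) (hQm.comp (measurable_update η))
    (fun h => (integral_sq_sum_nonneg_le ρ hu e₀ _).1)
    (fun h => (integral_sq_sum_nonneg_le ρ hu e₀ _).2) hφm hφ
  refine le_trans ?_ hX
  refine mul_le_mul_of_nonneg_left ?_ (Real.exp_nonneg _)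
  exact charVariance_le_integral_sq_update ρ hρ hN hd η

/-- **The two kernel bounds integrated against a DLR state.** For every Gibbs measure `μ` of the
Wilson specification at `β ≥ 0` (`G ≅ SU(N)`, `N ≥ 2`, `d ≥ 2`):
`∫ ∑_{p ∋ e₀} Re tr ρ(U_p) dμ ≥ β e^{-8(d-1)Nβ} V₀`. [folklore] -/
theorem integral_sum_plaquetteObs_ge (hρ : IsSpecialUnitaryModel ρ) (hN : 2 ≤ N) (hd : 2 ≤ d)
    {β : ℝ} (hβ : 0 ≤ β) {μ : Measure (LGConfig d G)} (hμ : μ ∈ ymGibbsMeasures ρ β) :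
    β * Real.exp (-(8 * ((d : ℝ) - 1) * N * β)) * PlaquetteLowerBound.charVariance ρ ≤
      ∫ U, ∑ p ∈ plaquettesTouching
          {plaqLink1 ((0 : Literature.Probability.LatticeModels.Site d), ⟨((0 : Fin d), (1 : Fin d)), fin_zero_lt_one hd⟩)},
        plaquetteObs ρ p.1 p.2.1.1 p.2.1.2 U ∂μ := by
  set p₀ : ZdPlaquette d := ((0 : Literature.Probability.LatticeModels.Site d),
    ⟨((0 : Fin d), (1 : Fin d)), fin_zero_lt_one hd⟩) with hp₀
  set e₀ := plaqLink1 p₀ with he₀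
  set f₀ := plaqLink2 p₀ with hf₀
  have hu := IsSpecialUnitaryModel.mem_unitaryGroup ρ hρ
  have hγ := isSpecification_ymSpecification_of_t2Space (d := d) ρ hρ.1 β
  rw [mem_ymGibbsMeasures_iff] at hμ
  haveI := hμ.isProbabilityMeasure
  set Q : LGConfig d G → ℝ := fun η' =>
    ∫ g, (∑ p ∈ plaquettesTouching {e₀}, (ρ g * ρ (staple p e₀ η')).trace.re) ^ 2 ∂haarProbability G
    with hQ
  set P : LGConfig d G → ℝ := fun U =>
    ∑ p ∈ plaquettesTouching {e₀}, plaquetteObs ρ p.1 p.2.1.1 p.2.1.2 U with hP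
  have hQm : Measurable Q := measurable_integral_sq_sum ρ hρ.1 e₀
  have hPm : Measurable P :=
    Finset.measurable_sum _ fun p _ => (continuous_plaquetteObs ρ hρ.1 _ _ _).measurable
  set M : ℝ := (plaquettesTouching {e₀}).card * N with hM
  have hPb : ∀ U, |P U| ≤ M := fun U => by
    calc |P U| ≤ ∑ p ∈ plaquettesTouching {e₀}, |plaquetteObs ρ p.1 p.2.1.1 p.2.1.2 U| :=
          Finset.abs_sum_le_sum_abs _ _
      _ ≤ ∑ _p ∈ plaquettesTouching {e₀}, (N : ℝ) := Finset.sum_le_sum fun p _ =>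
          abs_re_trace_le_of_mem_unitaryGroup (hu _)
      _ = M := by rw [Finset.sum_const, nsmul_eq_mul]
  -- Step 1: `∫ Q dμ ≥ e^{-D} V₀`
  set D : ℝ := β * (2 * N * (plaquettesTouching {f₀}).card) with hD
  have hQ1 : Real.exp (-D) * PlaquetteLowerBound.charVariance ρ ≤ ∫ η, Q η ∂μ :=
    le_integral_of_isGibbsMeasure hγ hμ {f₀} hQm (M := M ^ 2)
      (fun η => by
        rw [abs_of_nonneg (integral_sq_sum_nonneg_le ρ hu e₀ η).1]
        exact (integral_sq_sum_nonneg_le ρ hu e₀ η).2)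
      fun η => siteAvg_integral_sq_sum_ge ρ hρ hN hd hβ η
  -- Step 2: `∫ P dμ = ∫ γ_{e₀} P dμ ≥ β e^{-2βM} ∫ Q dμ`
  have hiP : Integrable P μ :=
    Integrable.of_bound hPm.aestronglyMeasurable M (ae_of_all _ fun U => by
      rw [Real.norm_eq_abs]; exact hPb U)
  have hP1 : β * Real.exp (-(2 * β * M)) * ∫ η, Q η ∂μ ≤ ∫ U, P U ∂μ := by
    rw [← hμ.integral_integral_eq hγ {e₀} hiP, ← integral_const_mul]
    refine integral_mono ?_ ?_ fun η => siteAvg_sum_plaquetteObs_ge ρ hρ hN hβ e₀ η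
    · exact (Integrable.of_bound hQm.aestronglyMeasurable (M ^ 2) (ae_of_all _ fun η => by
        rw [Real.norm_eq_abs, abs_of_nonneg (integral_sq_sum_nonneg_le ρ hu e₀ η).1]
        exact (integral_sq_sum_nonneg_le ρ hu e₀ η).2)).const_mul _
    · have hsm : Measurable (siteAvg (ymSpecification ρ β) e₀ P) := measurable_siteAvg hγ e₀ hPm
      exact Integrable.of_bound hsm.aestronglyMeasurable M (ae_of_all _ fun η => by
        rw [Real.norm_eq_abs]; exact abs_siteAvg_le hγ e₀ hPb η)
  -- Step 3: the counting `#{p ∋ e} = 2(d-1)` and monotonicity of `exp`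
  have hce : ((plaquettesTouching {e₀}).card : ℝ) = 2 * ((d : ℝ) - 1) := by
    rw [Balaban1983to89.Sufficient.card_plaquettesTouching_singleton e₀]
    have h1 : 1 ≤ d := by omega
    push_cast [Nat.cast_sub h1]
    ring
  have hcf : ((plaquettesTouching {f₀}).card : ℝ) = 2 * ((d : ℝ) - 1) := by
    rw [Balaban1983to89.Sufficient.card_plaquettesTouching_singleton f₀]
    have h1 : 1 ≤ d := by omega
    push_cast [Nat.cast_sub h1]
    ring
  have hV := (PlaquetteLowerBound.charVariance_pos ρ hρ.1 (by omega)).le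
  have hexp : Real.exp (-(8 * ((d : ℝ) - 1) * N * β)) = Real.exp (-(2 * β * M)) * Real.exp (-D) := by
    rw [← Real.exp_add, hM, hD, hce, hcf]
    ring_nf
  calc β * Real.exp (-(8 * ((d : ℝ) - 1) * N * β)) * PlaquetteLowerBound.charVariance ρ
      = β * Real.exp (-(2 * β * M)) * (Real.exp (-D) * PlaquetteLowerBound.charVariance ρ) := by
        rw [hexp]; ring
    _ ≤ β * Real.exp (-(2 * β * M)) * ∫ η, Q η ∂μ :=
        mul_le_mul_of_nonneg_left hQ1 (by positivity)
    _ ≤ ∫ U, P U ∂μ := hP1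

end Kernel

end PlaquettePositivity

end Summit.Ventures.YMGap.RobustBall
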